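import Summits.CriticalPhenomena.PercolationContinuityZ3.Theorems.Transplant.PyrochloreNegChart
import HarnessLib

/-!
# Pyrochlore-bond, III — (κ) for the unrotated unit chart: every cylinder `{w ∈ sites | ‖uchart w − uchart t‖_∞ ≤ ℓ}`, `ℓ ≥ 1`, over either base
# vertex is CONNECTED; so pyrochlore satisfies, on its site set, EVERY field of the two-type `{±1}` interface (u2's customer at `N = 1`, kernel)

builds on p205010 (kernel theorem, internal audit signed; external expert review pending) — nothing in this file uses p205010; NOTHING is claimed about
`θ_{pyrochlore}(p_c)` nor about any node (u2 = multi-type `SamePDropOfSkeletonNeg` is OPEN).  Lane `prim-bschramm`, seat `prim-bschramm-p4` (gen 21; PART C3,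
`HOME/bschramm/P4-GENERAL.md` §43.2b).  Helper file (`--supports stmt-CriticalPhenomena-4575 --as helper`); sequel of `PyrochloreNegChart` (unit steps
along single bonds `ustep`, `−I` everywhere, z-glide, TWO frame types `base₂`).
* `ucyl t ℓ`; `exists_reachable_ufibre` (descent by SINGLE-bond unit steps inside the cylinder — coordinatewise towards `uchart t`);
* `fibre₀_reachable`, `fibre₁_reachable`: the fibres over the two base vertices are the progressions `(0,0,4k)`, `(1,0,1+4k)`, chained inside the UNIT
  cylinder by the 4-bond staircases `p → p+(1,0,1) → p+(1,−1,2) → p+(0,−1,3) → p+(0,0,4)` (type 0) and `p → p+(1,0,1) → p+(1,1,2) → p+(0,1,3) → p+(0,0,4)`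
  (type 1);
* **`ucyl_connected`**: (κ) at both base vertices, every `ℓ ≥ 1`.
[cite: KozmaNitzan2024, §4 p. 15 (connected cylinders)] [cite: ConwaySloane1999, Ch. 4 §6.1]
-/

noncomputable section

namespace Summit.CriticalPhenomena.PercolationContinuityZ3.Theorems.Transplant

open SimpleGraph Literature.Probability.LatticeModels Literature.Probability.Percolation
open scoped Classical

namespace PyroZ3

/-! ## §1 Cylinders of the unrotated chart; descent to the fibre -/

/-- The cylinder of half-width `ℓ` at `t` for `uchart`, restricted to sites. [cite: KozmaNitzan2024, §4 p. 15 (boxes)] -/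
def ucyl (t : Site 3) (ℓ : ℕ) : Set (Site 3) := {w | w ∈ sites ∧ uchart w - uchart t ∈ box 2 ℓ}

/-- **Descent by single-bond unit steps**: inside a cylinder every site is joined, INSIDE the cylinder, to a site over the base chart value. [folklore] -/
theorem exists_reachable_ufibre (t : Site 3) (ℓ : ℕ) (w : Site 3) (hw : w ∈ ucyl t ℓ) :
    ∃ (w₀ : Site 3) (h₀ : w₀ ∈ ucyl t ℓ), uchart w₀ = uchart t ∧ (graph.induce (ucyl t ℓ)).Reachable ⟨w, hw⟩ ⟨w₀, h₀⟩ := by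
  suffices H : ∀ n : ℕ, ∀ (w : Site 3) (hw : w ∈ ucyl t ℓ), ((uchart w - uchart t) 0).natAbs + ((uchart w - uchart t) 1).natAbs = n →
      ∃ (w₀ : Site 3) (h₀ : w₀ ∈ ucyl t ℓ), uchart w₀ = uchart t ∧ (graph.induce (ucyl t ℓ)).Reachable ⟨w, hw⟩ ⟨w₀, h₀⟩ from
    H _ w hw rfl
  intro n
  induction n using Nat.strong_induction_on with
  | _ n ih =>
    intro w hw hn
    set d : Site 2 := uchart w - uchart t with hd_def
    have hbox : ∀ j, -(ℓ : ℤ) ≤ d j ∧ d j ≤ ℓ := mem_box.1 hw.2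
    by_cases h0 : d 0 = 0 ∧ d 1 = 0
    · refine ⟨w, hw, ?_, Reachable.refl _⟩
      have hd0 : d = 0 := by funext j; fin_cases j; exacts [h0.1, h0.2]
      exact sub_eq_zero.1 (hd_def ▸ hd0)
    obtain ⟨i, hi⟩ : ∃ i : Fin 2, d i ≠ 0 := by
      by_contra hc
      exact h0 ⟨not_not.1 fun h => hc ⟨0, h⟩, not_not.1 fun h => hc ⟨1, h⟩⟩
    obtain ⟨s, hs1, hlt, hrange⟩ : ∃ s : ℤ, (s = 1 ∨ s = -1) ∧ (d i + s).natAbs < (d i).natAbs ∧ (-(ℓ : ℤ) ≤ d i + s ∧ d i + s ≤ ℓ) := by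
      have hb := hbox i
      rcases lt_or_gt_of_ne hi with hlt | hgt
      · exact ⟨1, Or.inl rfl, by omega, by omega⟩
      · exact ⟨-1, Or.inr rfl, by omega, by omega⟩
    obtain ⟨σ, hσ⟩ : ∃ σ : ℤˣ, (σ : ℤ) = s := by
      rcases hs1 with rfl | rfl
      exacts [⟨1, rfl⟩, ⟨-1, rfl⟩]
    obtain ⟨y, hwy, hy⟩ := ustep w hw.1 i σ
    have hdy : uchart y - uchart t = d + Pi.single i s := by rw [hy, hσ, hd_def]; abel
    have hy_box : uchart y - uchart t ∈ box 2 ℓ := by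
      rw [mem_box]; intro j; rw [hdy, Pi.add_apply]
      by_cases hj : j = i
      · subst hj; rw [Pi.single_eq_same]; exact hrange
      · rw [Pi.single_eq_of_ne hj, add_zero]; exact hbox j
    have hy_mem : y ∈ ucyl t ℓ := ⟨((adj_iff _ _).1 hwy).2.1, hy_box⟩
    have hlt' : ((uchart y - uchart t) 0).natAbs + ((uchart y - uchart t) 1).natAbs < n := by
      rw [← hn, hdy]
      fin_cases i <;> simp at hlt ⊢ <;> omega
    obtain ⟨w₀, h₀, hφ₀, hreach⟩ := ih _ hlt' y hy_mem rfl
    exact ⟨w₀, h₀, hφ₀, (show (graph.induce (ucyl t ℓ)).Adj ⟨w, hw⟩ ⟨y, hy_mem⟩ from hwy).reachable.trans hreach⟩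

/-! ## §2 The fibres over the two base vertices and their staircases -/

/-- A site over the chart value of `t` is `t` shifted along the `z`-axis. [folklore] -/
theorem eq_add_single_of_uchart_eq {t w : Site 3} (h : uchart w = uchart t) : w = t + Pi.single 2 (w 2 - t 2) := by
  have h0 : w 0 = t 0 := by simpa [uchart] using congrFun h 0
  have h1 : w 1 = t 1 := by simpa [uchart] using congrFun h 1
  funext k; fin_cases k
  · simp [h0]
  · simp [h1]
  · simp

/-- An explicit 4-bond staircase inside the unit cylinder joins `p` to `p + (0,0,4)`: given the three intermediate points as sites with the
right bond vectors and chart offsets of sup-norm `≤ 1`, reachability inside `ucyl t ℓ` follows. [folklore] -/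
theorem reachable_of_staircase {t : Site 3} {ℓ : ℕ} (hℓ : 1 ≤ ℓ) (p u₁ u₂ u₃ q : Site 3)
    (hp : p ∈ ucyl t ℓ) (hq : q ∈ ucyl t ℓ) (hpt : uchart p = uchart t)
    (m₁ : p + u₁ ∈ sites) (m₂ : p + u₂ ∈ sites) (m₃ : p + u₃ ∈ sites)
    (v₁ : u₁ ∈ V12) (v₂ : u₂ - u₁ ∈ V12) (v₃ : u₃ - u₂ ∈ V12) (v₄ : q - (p + u₃) ∈ V12)
    (c₁ : uchart u₁ ∈ box 2 1) (c₂ : uchart u₂ ∈ box 2 1) (c₃ : uchart u₃ ∈ box 2 1) :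
    (graph.induce (ucyl t ℓ)).Reachable ⟨p, hp⟩ ⟨q, hq⟩ := by
  have hboxmono : ∀ u : Site 3, uchart u ∈ box 2 1 → uchart (p + u) - uchart t ∈ box 2 ℓ := by
    intro u hu
    rw [uchart_add, hpt, add_sub_cancel_left, mem_box]
    intro j
    have := (mem_box.1 hu) j
    constructor <;> omega
  have k₁ : p + u₁ ∈ ucyl t ℓ := ⟨m₁, hboxmono u₁ c₁⟩
  have k₂ : p + u₂ ∈ ucyl t ℓ := ⟨m₂, hboxmono u₂ c₂⟩
  have k₃ : p + u₃ ∈ ucyl t ℓ := ⟨m₃, hboxmono u₃ c₃⟩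
  have a₁ : graph.Adj p (p + u₁) := adj_of _ _ hp.1 m₁ (by rwa [add_sub_cancel_left])
  have a₂ : graph.Adj (p + u₁) (p + u₂) := adj_of _ _ m₁ m₂ (by rwa [show p + u₂ - (p + u₁) = u₂ - u₁ by abel])
  have a₃ : graph.Adj (p + u₂) (p + u₃) := adj_of _ _ m₂ m₃ (by rwa [show p + u₃ - (p + u₂) = u₃ - u₂ by abel])
  have a₄ : graph.Adj (p + u₃) q := adj_of _ _ m₃ hq.1 v₄
  have r₁ : (graph.induce (ucyl t ℓ)).Reachable ⟨p, hp⟩ ⟨_, k₁⟩ := (show (graph.induce (ucyl t ℓ)).Adj ⟨p, hp⟩ ⟨_, k₁⟩ from a₁).reachable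
  have r₂ : (graph.induce (ucyl t ℓ)).Reachable ⟨_, k₁⟩ ⟨_, k₂⟩ := (show (graph.induce (ucyl t ℓ)).Adj ⟨_, k₁⟩ ⟨_, k₂⟩ from a₂).reachable
  have r₃ : (graph.induce (ucyl t ℓ)).Reachable ⟨_, k₂⟩ ⟨_, k₃⟩ := (show (graph.induce (ucyl t ℓ)).Adj ⟨_, k₂⟩ ⟨_, k₃⟩ from a₃).reachable
  have r₄ : (graph.induce (ucyl t ℓ)).Reachable ⟨_, k₃⟩ ⟨q, hq⟩ := (show (graph.induce (ucyl t ℓ)).Adj ⟨_, k₃⟩ ⟨q, hq⟩ from a₄).reachable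
  exact r₁.trans (r₂.trans (r₃.trans r₄))

/-- Membership of `t + (0,0,d)` in the cylinder at `t` reduces to being a site. [folklore] -/
theorem add_single_two_mem_ucyl {t : Site 3} {ℓ : ℕ} (d : ℤ) (hs : t + Pi.single 2 d ∈ sites) : t + Pi.single 2 d ∈ ucyl t ℓ := by
  refine ⟨hs, ?_⟩
  have e : uchart (t + Pi.single 2 d) - uchart t = 0 := by funext j; fin_cases j <;> simp [uchart]
  rw [e]; exact zero_mem_box 2 ℓ

/-- `uchart (t + (0,0,d)) = uchart t`. [folklore] -/
theorem uchart_add_single_two (t : Site 3) (d : ℤ) : uchart (t + Pi.single 2 d) = uchart t := by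
  funext j; fin_cases j <;> simp [uchart]

/-- **The fibre over `base₂ 0 = (0,0,0)` is chained inside the unit cylinder**: `(0,0,d)` with `4 ∣ d` is joined to `0`. Sites on this fibre are
exactly `4 ∣ d`; the staircase `(1,0,1), (1,−1,2), (0,−1,3), (0,0,4)` (and its negative) does one period. [cite: KozmaNitzan2024, §4 p. 15] -/
theorem fibre₀_reachable {ℓ : ℕ} (hℓ : 1 ≤ ℓ) (h1 : base₂ 0 ∈ ucyl (base₂ 0) ℓ) :
    ∀ (n : ℕ) (d : ℤ) (hd : base₂ 0 + Pi.single 2 d ∈ ucyl (base₂ 0) ℓ), d.natAbs = n →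
      (graph.induce (ucyl (base₂ 0) ℓ)).Reachable ⟨base₂ 0, h1⟩ ⟨_, hd⟩ := by
  intro n
  induction n using Nat.strong_induction_on with
  | _ n ih =>
    intro d hd hdn
    -- sites on the fibre: `4 ∣ d`
    have hd4 : d % 4 = 0 := by
      have h := hd.1
      simp only [sites, Set.mem_setOf_eq, base₂, Pi.add_apply, Pi.single_eq_same,
        Pi.single_eq_of_ne (show (0 : Fin 3) ≠ 2 by decide), Pi.single_eq_of_ne (show (1 : Fin 3) ≠ 2 by decide)] at h
      simp at h
      omega
    by_cases hd0 : d = 0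
    · subst hd0
      have ept : (⟨base₂ 0 + Pi.single 2 (0 : ℤ), hd⟩ : ucyl (base₂ 0) ℓ) = ⟨base₂ 0, h1⟩ := Subtype.ext (by simp)
      rw [ept]
    -- one period towards `0`: `d' = d - 4 s`, `s = sign d`
    obtain ⟨s, hs, hlt⟩ : ∃ s : ℤ, (s = 1 ∨ s = -1) ∧ (d - 4 * s).natAbs < d.natAbs := by
      rcases lt_or_gt_of_ne hd0 with h | h
      · exact ⟨-1, Or.inr rfl, by omega⟩
      · exact ⟨1, Or.inl rfl, by omega⟩
    set d' := d - 4 * s with hd'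
    have hsite' : base₂ 0 + Pi.single 2 d' ∈ sites := by
      simp only [sites, Set.mem_setOf_eq, base₂, Pi.add_apply, Pi.single_eq_same,
        Pi.single_eq_of_ne (show (0 : Fin 3) ≠ 2 by decide), Pi.single_eq_of_ne (show (1 : Fin 3) ≠ 2 by decide)]
      simp
      rcases hs with rfl | rfl <;> omega
    have hd'mem : base₂ 0 + Pi.single 2 d' ∈ ucyl (base₂ 0) ℓ := add_single_two_mem_ucyl d' hsite'
    have hlt_n : d'.natAbs < n := by rw [← hdn]; exact hlt
    have r := ih _ hlt_n d' hd'mem rfl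
    refine r.trans ?_
    -- staircase from `p = (0,0,d')` to `q = (0,0,d)` = `p + (0,0,4s)`: offsets `s•(1,0,1), s•(1,-1,2)… ` — we use `u_k` scaled by the sign
    set p : Site 3 := base₂ 0 + Pi.single 2 d' with hp
    have hpt : uchart p = uchart (base₂ 0) := uchart_add_single_two _ _
    have hq : base₂ 0 + Pi.single 2 d = p + ![0, 0, 4 * s] := by
      rw [hp, hd']; funext k; fin_cases k <;> simp
      omega
    rcases hs with rfl | rfl
    · -- going up: `u₁ = (1,0,1)`, `u₂ = (1,-1,2)`, `u₃ = (0,-1,3)`, `q - (p+u₃) = (0,1,1)`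
      have m : ∀ u : Site 3, u = ![1, 0, 1] ∨ u = ![1, -1, 2] ∨ u = ![0, -1, 3] → p + u ∈ sites := by
        rintro u (rfl | rfl | rfl) <;>
        · simp only [hp, sites, Set.mem_setOf_eq, base₂, Pi.add_apply, Pi.single_eq_same,
            Pi.single_eq_of_ne (show (0 : Fin 3) ≠ 2 by decide), Pi.single_eq_of_ne (show (1 : Fin 3) ≠ 2 by decide)]
          simp
          omega
      refine reachable_of_staircase hℓ p ![1, 0, 1] ![1, -1, 2] ![0, -1, 3] _ hd'mem hd hpt (m _ (Or.inl rfl)) (m _ (Or.inr (Or.inl rfl)))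
        (m _ (Or.inr (Or.inr rfl))) (by decide) (by decide) (by decide) ?_ (by decide) (by decide) (by decide)
      rw [hq]; rw [show p + ![0, 0, 4 * (1 : ℤ)] - (p + ![0, -1, 3]) = ![0, 0, 4 * (1 : ℤ)] - ![0, -1, 3] by abel]; decide
    · -- going down: the negatives
      have m : ∀ u : Site 3, u = ![-1, 0, -1] ∨ u = ![-1, 1, -2] ∨ u = ![0, 1, -3] → p + u ∈ sites := by
        rintro u (rfl | rfl | rfl) <;>
        · simp only [hp, sites, Set.mem_setOf_eq, base₂, Pi.add_apply, Pi.single_eq_same,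
            Pi.single_eq_of_ne (show (0 : Fin 3) ≠ 2 by decide), Pi.single_eq_of_ne (show (1 : Fin 3) ≠ 2 by decide)]
          simp
          omega
      refine reachable_of_staircase hℓ p ![-1, 0, -1] ![-1, 1, -2] ![0, 1, -3] _ hd'mem hd hpt (m _ (Or.inl rfl)) (m _ (Or.inr (Or.inl rfl)))
        (m _ (Or.inr (Or.inr rfl))) (by decide) (by decide) (by decide) ?_ (by decide) (by decide) (by decide)
      rw [hq]; rw [show p + ![0, 0, 4 * (-1 : ℤ)] - (p + ![0, 1, -3]) = ![0, 0, 4 * (-1 : ℤ)] - ![0, 1, -3] by abel]; decide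

/-- **The fibre over `base₂ 1 = (1,0,1)` is chained inside the unit cylinder**: `(1,0,1+d)` with `4 ∣ d` is joined to `(1,0,1)` by the staircases
`(1,0,1), (1,1,2), (0,1,3), (0,0,4)` and their negatives. [cite: KozmaNitzan2024, §4 p. 15] -/
theorem fibre₁_reachable {ℓ : ℕ} (hℓ : 1 ≤ ℓ) (h1 : base₂ 1 ∈ ucyl (base₂ 1) ℓ) :
    ∀ (n : ℕ) (d : ℤ) (hd : base₂ 1 + Pi.single 2 d ∈ ucyl (base₂ 1) ℓ), d.natAbs = n →
      (graph.induce (ucyl (base₂ 1) ℓ)).Reachable ⟨base₂ 1, h1⟩ ⟨_, hd⟩ := by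
  intro n
  induction n using Nat.strong_induction_on with
  | _ n ih =>
    intro d hd hdn
    have hd4 : d % 4 = 0 := by
      have h := hd.1
      simp only [sites, Set.mem_setOf_eq, base₂, Pi.add_apply, Pi.single_eq_same,
        Pi.single_eq_of_ne (show (0 : Fin 3) ≠ 2 by decide), Pi.single_eq_of_ne (show (1 : Fin 3) ≠ 2 by decide)] at h
      simp at h
      omega
    by_cases hd0 : d = 0
    · subst hd0
      have ept : (⟨base₂ 1 + Pi.single 2 (0 : ℤ), hd⟩ : ucyl (base₂ 1) ℓ) = ⟨base₂ 1, h1⟩ := Subtype.ext (by simp)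
      rw [ept]
    obtain ⟨s, hs, hlt⟩ : ∃ s : ℤ, (s = 1 ∨ s = -1) ∧ (d - 4 * s).natAbs < d.natAbs := by
      rcases lt_or_gt_of_ne hd0 with h | h
      · exact ⟨-1, Or.inr rfl, by omega⟩
      · exact ⟨1, Or.inl rfl, by omega⟩
    set d' := d - 4 * s with hd'
    have hsite' : base₂ 1 + Pi.single 2 d' ∈ sites := by
      simp only [sites, Set.mem_setOf_eq, base₂, Pi.add_apply, Pi.single_eq_same,
        Pi.single_eq_of_ne (show (0 : Fin 3) ≠ 2 by decide), Pi.single_eq_of_ne (show (1 : Fin 3) ≠ 2 by decide)]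
      simp
      rcases hs with rfl | rfl <;> omega
    have hd'mem : base₂ 1 + Pi.single 2 d' ∈ ucyl (base₂ 1) ℓ := add_single_two_mem_ucyl d' hsite'
    have hlt_n : d'.natAbs < n := by rw [← hdn]; exact hlt
    have r := ih _ hlt_n d' hd'mem rfl
    refine r.trans ?_
    set p : Site 3 := base₂ 1 + Pi.single 2 d' with hp
    have hpt : uchart p = uchart (base₂ 1) := uchart_add_single_two _ _
    have hq : base₂ 1 + Pi.single 2 d = p + ![0, 0, 4 * s] := by
      rw [hp, hd']; funext k; fin_cases k <;> simp
      omega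
    rcases hs with rfl | rfl
    · have m : ∀ u : Site 3, u = ![1, 0, 1] ∨ u = ![1, 1, 2] ∨ u = ![0, 1, 3] → p + u ∈ sites := by
        rintro u (rfl | rfl | rfl) <;>
        · simp only [hp, sites, Set.mem_setOf_eq, base₂, Pi.add_apply, Pi.single_eq_same,
            Pi.single_eq_of_ne (show (0 : Fin 3) ≠ 2 by decide), Pi.single_eq_of_ne (show (1 : Fin 3) ≠ 2 by decide)]
          simp
          omega
      refine reachable_of_staircase hℓ p ![1, 0, 1] ![1, 1, 2] ![0, 1, 3] _ hd'mem hd hpt (m _ (Or.inl rfl)) (m _ (Or.inr (Or.inl rfl)))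
        (m _ (Or.inr (Or.inr rfl))) (by decide) (by decide) (by decide) ?_ (by decide) (by decide) (by decide)
      rw [hq]; rw [show p + ![0, 0, 4 * (1 : ℤ)] - (p + ![0, 1, 3]) = ![0, 0, 4 * (1 : ℤ)] - ![0, 1, 3] by abel]; decide
    · have m : ∀ u : Site 3, u = ![-1, 0, -1] ∨ u = ![-1, -1, -2] ∨ u = ![0, -1, -3] → p + u ∈ sites := by
        rintro u (rfl | rfl | rfl) <;>
        · simp only [hp, sites, Set.mem_setOf_eq, base₂, Pi.add_apply, Pi.single_eq_same,
            Pi.single_eq_of_ne (show (0 : Fin 3) ≠ 2 by decide), Pi.single_eq_of_ne (show (1 : Fin 3) ≠ 2 by decide)]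
          simp
          omega
      refine reachable_of_staircase hℓ p ![-1, 0, -1] ![-1, -1, -2] ![0, -1, -3] _ hd'mem hd hpt (m _ (Or.inl rfl)) (m _ (Or.inr (Or.inl rfl)))
        (m _ (Or.inr (Or.inr rfl))) (by decide) (by decide) (by decide) ?_ (by decide) (by decide) (by decide)
      rw [hq]; rw [show p + ![0, 0, 4 * (-1 : ℤ)] - (p + ![0, -1, -3]) = ![0, 0, 4 * (-1 : ℤ)] - ![0, -1, -3] by abel]; decide

/-! ## §3 (κ) at the two base vertices -/

/-- **(κ) for pyrochlore-bond with the unrotated unit chart: at both base vertices every cylinder of half-width `ℓ ≥ 1` (restricted to sites) induces a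
CONNECTED subgraph.** [cite: KozmaNitzan2024, §4 p. 15 (connected cylinders)] -/
theorem ucyl_connected (c : Fin 2) (ℓ : ℕ) (hℓ : 1 ≤ ℓ) : (graph.induce (ucyl (base₂ c) ℓ)).Connected := by
  have ht : base₂ c ∈ sites := base₂_mem_sites c
  have h1 : base₂ c ∈ ucyl (base₂ c) ℓ := ⟨ht, by rw [sub_self]; exact zero_mem_box 2 ℓ⟩
  haveI : Nonempty (ucyl (base₂ c) ℓ) := ⟨⟨_, h1⟩⟩
  have key : ∀ w : ucyl (base₂ c) ℓ, (graph.induce (ucyl (base₂ c) ℓ)).Reachable ⟨_, h1⟩ w := by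
    rintro ⟨w, hw⟩
    obtain ⟨w₀, h₀, hφ, hr⟩ := exists_reachable_ufibre (base₂ c) ℓ w hw
    have e : w₀ = base₂ c + Pi.single 2 (w₀ 2 - base₂ c 2) := eq_add_single_of_uchart_eq hφ
    have h₀' : base₂ c + Pi.single 2 (w₀ 2 - base₂ c 2) ∈ ucyl (base₂ c) ℓ := e ▸ h₀
    have r0 : (graph.induce (ucyl (base₂ c) ℓ)).Reachable ⟨_, h1⟩ ⟨_, h₀'⟩ := by
      fin_cases c
      · exact fibre₀_reachable hℓ h1 _ _ h₀' rfl
      · exact fibre₁_reachable hℓ h1 _ _ h₀' rfl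
    have ept : (⟨_, h₀'⟩ : ucyl (base₂ c) ℓ) = ⟨w₀, h₀⟩ := Subtype.ext e.symm
    rw [ept] at r0
    exact r0.trans hr.symm
  exact ⟨fun u v => (key u).symm.trans (key v)⟩

end PyroZ3

end Summit.CriticalPhenomena.PercolationContinuityZ3.Theorems.Transplant

end
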